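import Summits.Ventures.PercRepro.ProfilePointedCircuitClassesSixTop
import Summits.Ventures.PercRepro.ProfilePointedCircuitClassesInOutParallel
import Summits.Ventures.PercRepro.ProfilePointedCircuitClassesInOutColoop
import Summits.Ventures.PercRepro.ProfilePointedCircuitClassesSevenE

/-!
# PercRepro — THE PER-POINT IN–OUT INEQUALITY AT THE BOTTOM OF NULLITY 5: THE REDUCTIONS (p5, gen 42;
`proofs/P5-GM1.md` §63)

What is a theorem about `InOutBottomFive` (`in_5(e) ≤ out_6(e)` on `#E = ρ(E) + 5`, `ρ(E) ≥ 7`), one nullity above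
§53 ADD 6–8 / §61 (D): the loop and coloop cases (`in_5(e) = 0`), the twin case (`e ∥ f`: both sides are profile
values of the nullity-4 minor `N ／ f ∖ e`, and the claim is `P_4 ≤ P_5` there — `biIndep_step_four_of_nullity_four`),
the rank-6 row (`#E = 11`: `in_5(e) = out_6(e)` by complementation), and the deletion of a coloop `x ≠ e`
(generic in the level: `inCount_bottom_le_inCount_delete_of_coloop`, `outCount_delete_le_outCount_of_coloop'`).
Hence **`InOutBottomFive` holds as soon as it holds on coloop-free matroids at twin-free non-loop points**
(`inOutBottomFive_of_coloopFree_twinFree`, by strong induction on `#E`) — the shape in which the census-clean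
charging certificate of §63 is to be proved.
-/

open scoped Matroid

namespace PercRepro.Cogirth

open Finset ThmH Skew Shadow Profile

variable {α : Type} [DecidableEq α] {N : Matroid α} [N.Finite]

section InOutFive

/-- **The bottom-level demands survive the deletion of a coloop `x ≠ e`**, at every nullity `ν = #E − ρ(E)`: a
bi-independent `ν`-set `W ∋ e` avoids `x` (the basis `E ∖ W` contains every coloop) and stays bi-independent in
`N ∖ x` (the level-`4` statement of gen 41, `inCount_le_inCount_delete_of_coloop`, generalised). -/
theorem inCount_bottom_le_inCount_delete_of_coloop {ν : ℕ} {e x : α} (hn : (gr N).card = rk N (gr N) + ν)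
    (hco : rk N ((gr N).erase x) < rk N (gr N)) :
    inCount N ν e ≤ inCount (N ＼ ({x} : Set α)) ν e := by
  unfold inCount
  apply card_le_card
  intro W hW
  rw [mem_filter, mem_biIndepSets] at hW
  obtain ⟨⟨hWg, hWν, hWr, hWc⟩, heW⟩ := hW
  have hBcard : (gr N \ W).card = rk N (gr N) := by rw [card_sdiff_of_subset hWg, hn, hWν]; omega
  have hxW : x ∉ W := by
    intro hxW
    have hsub : gr N \ W ⊆ (gr N).erase x := by
      intro g hg
      rw [mem_sdiff] at hg
      exact mem_erase.2 ⟨fun h => hg.2 (h ▸ hxW), hg.1⟩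
    have h1 := rk_mono' (M := N) hsub
    omega
  have hWx : W ⊆ (gr N).erase x := fun g hg => mem_erase.2 ⟨fun h => hxW (h ▸ hg), hWg hg⟩
  rw [mem_filter, mem_biIndepSets, gr_delete']
  refine ⟨⟨hWx, hWν, ?_, ?_⟩, heW⟩
  · rw [rk_delete hWx]; exact hWr
  · have e1 : (gr N).erase x \ W = (gr N \ W).erase x := by
      ext g
      rw [mem_sdiff, mem_erase, mem_erase, mem_sdiff]
      tauto
    rw [e1, rk_delete (erase_subset_erase x sdiff_subset)]
    exact rk_eq_card_of_subset_of_rk_eq_card (erase_subset x (gr N \ W)) hWc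

/-- **The units of `N ∖ x` are units of `N`** for a coloop `x`, at every level `k`: a bi-independent `k`-set
`W' ∌ e` of `N ∖ x` is bi-independent in `N` (adding the coloop `x` to the independent `E ∖ x ∖ W'` keeps it
independent; gen 41's `outCount_delete_le_outCount_of_coloop` at the level `5`, generalised). -/
theorem outCount_delete_le_outCount_of_coloop' (k : ℕ) {e x : α} (hx : x ∈ gr N)
    (hco : rk N ((gr N).erase x) < rk N (gr N)) :
    outCount (N ＼ ({x} : Set α)) k e ≤ outCount N k e := by
  unfold outCount
  apply card_le_card
  intro W' hW'
  rw [mem_filter, mem_biIndepSets, gr_delete'] at hW'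
  obtain ⟨⟨hW'g, hW'k, hW'r, hW'c⟩, heW'⟩ := hW'
  rw [rk_delete hW'g] at hW'r
  rw [rk_delete (sdiff_subset (s := (gr N).erase x) (t := W'))] at hW'c
  rw [mem_filter, mem_biIndepSets]
  refine ⟨⟨hW'g.trans (erase_subset x (gr N)), hW'k, hW'r, ?_⟩, heW'⟩
  have hxW' : x ∉ W' := fun h => (mem_erase.1 (hW'g h)).1 rfl
  have e1 : gr N \ W' = insert x ((gr N).erase x \ W') := by
    ext g
    rw [mem_sdiff, mem_insert, mem_sdiff, mem_erase]
    constructor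
    · rintro ⟨hg, hgW⟩
      by_cases hgx : g = x
      · exact Or.inl hgx
      · exact Or.inr ⟨⟨hgx, hg⟩, hgW⟩
    · rintro (h | ⟨⟨_, hg⟩, hgW⟩)
      · rw [h]; exact ⟨hx, hxW'⟩
      · exact ⟨hg, hgW⟩
  have hZ : (gr N).erase x \ W' ⊆ (gr N).erase x := sdiff_subset
  have hxZ : x ∉ (gr N).erase x \ W' := fun h => (mem_erase.1 (mem_sdiff.1 h).1).1 rfl
  rw [e1, rk_insert_eq hx (hZ.trans (erase_subset x (gr N))), if_neg (notMem_clF_of_rk_erase_lt hx hco hZ), hW'c,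
    card_insert_of_notMem hxZ]

/-- **THE COLOOP CASE OF `InOutBottomFive`**: `in_5(e) = 0 ≤ out_6(e)` on `#E = ρ(E) + 5` when `e` is a coloop. -/
theorem inCount_five_le_outCount_six_of_coloop (hn : (gr N).card = rk N (gr N) + 5) {e : α}
    (hco : rk N ((gr N).erase e) < rk N (gr N)) : inCount N 5 e ≤ outCount N 6 e := by
  have h := inCount_eq_zero_of_coloop hco
  have e5 : (gr N).card - rk N (gr N) = 5 := by omega
  rw [e5] at h
  rw [h]
  exact Nat.zero_le _

/-- **THE LOOP CASE OF `InOutBottomFive`**: `in_5(e) = 0 ≤ out_6(e)` when `e` is a loop. -/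
theorem inCount_five_le_outCount_six_of_loop {e : α} (hl : rk N {e} = 0) : inCount N 5 e ≤ outCount N 6 e := by
  rw [inCount_eq_zero_of_rk_ne_one e 5 (by omega)]
  exact Nat.zero_le _

/-- **THE RANK-6 ROW**: on `#E = 11 = ρ(E) + 5` with `ρ(E) = 6`, `in_5(e) = out_6(e)` (complementation
`inCount_sub_eq_outCount`: the bi-independent `5`-sets through `e` are the complements of the bi-independent `6`-sets
avoiding `e`). -/
theorem inCount_five_eq_outCount_six_of_rk_eq_six (hn : (gr N).card = rk N (gr N) + 5)
    (hR : rk N (gr N) = 6) {e : α} (he : e ∈ gr N) : inCount N 5 e = outCount N 6 e := by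
  have h := inCount_sub_eq_outCount (M := N) (k := 6) he (by omega)
  have e5 : (gr N).card - 6 = 5 := by omega
  rwa [e5] at h

/-- **THE TWIN CASE OF `InOutBottomFive`**: on `#E = ρ(E) + 5`, `ρ(E) ≥ 7`, every point `e` with a parallel twin `f`
satisfies `in_5(e) ≤ out_6(e)` — both sides are profile values of the nullity-4 minor `N ／ f ∖ e`
(`in_5(e) = P_4`, `out_6(e) = in_{n−6}(e) = P_{n−7} = P_5` by symmetry) and the claim is `P_4 ≤ P_5` there
(`biIndep_step_four_of_nullity_four`: `(n° − 4)·P_4 ≤ 5·P_5` with `n° − 4 = ρ − 1 ≥ 6`). -/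
theorem inCount_five_le_outCount_six_of_parallel (hn : (gr N).card = rk N (gr N) + 5)
    (hR : 7 ≤ rk N (gr N)) {e f : α} (hef : e ≠ f) (he : e ∈ gr N) (hf : f ∈ gr N)
    (hre : rk N {e} = 1) (hrf : rk N {f} = 1) (hfcl : f ∈ clF N {e}) :
    inCount N 5 e ≤ outCount N 6 e := by
  have hC : ({e} : Finset α) ⊆ gr N := singleton_subset_iff.2 he
  have hxC : f ∉ ({e} : Finset α) := by rw [mem_singleton]; exact fun h => hef h.symm
  have hrk : rk N {e} = ({e} : Finset α).card := by rw [hre, card_singleton]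
  have hfund : ∀ c ∈ ({e} : Finset α), f ∉ clF N (({e} : Finset α).erase c) := by
    intro c hc
    rw [mem_singleton] at hc
    rw [hc, erase_singleton]
    intro h0
    have h := rk_insert_eq hf (empty_subset (gr N)) (M := N)
    rw [insert_empty, if_pos h0] at h
    have h1 : rk N ∅ = 0 := Nat.le_zero.1 ((rk_le_card (M := N) ∅).trans (by rw [card_empty]))
    omega
  have hout : outCount N 6 e = inCount N ((gr N).card - 6) e :=
    (inCount_sub_eq_outCount (M := N) (k := 6) he (by omega)).symm
  rw [hout, inCount_eq_gammaC_of_parallel hef he hf hre hrf hfcl,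
    inCount_eq_gammaC_of_parallel hef he hf hre hrf hfcl,
    gammaC_eq_thruCount_contract_delete hC hf hxC hrk hfcl hfund (mem_singleton_self e) (by norm_num),
    gammaC_eq_thruCount_contract_delete hC hf hxC hrk hfcl hfund (mem_singleton_self e) (by omega),
    erase_singleton, thruCount_empty, thruCount_empty]
  obtain ⟨hgr₀, hcard₀, hrkg₀⟩ :=
    minor_facts_of_circuit hC hf hxC hrk hfcl hfund hrf (mem_singleton_self e)
  have hn₀ : (gr ((N ／ ({f} : Set α)) ＼ ({e} : Set α))).card =
      rk ((N ／ ({f} : Set α)) ＼ ({e} : Set α)) (gr ((N ／ ({f} : Set α)) ＼ ({e} : Set α))) + 4 := by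
    rw [hcard₀, hrkg₀]
    omega
  have hR₀ : 6 ≤ rk ((N ／ ({f} : Set α)) ＼ ({e} : Set α)) (gr ((N ／ ({f} : Set α)) ＼ ({e} : Set α))) := by
    rw [hrkg₀]
    omega
  have hstep := biIndep_step_four_of_nullity_four (N := (N ／ ({f} : Set α)) ＼ ({e} : Set α)) hn₀ hR₀
  have hsym := card_biIndepSets_symm ((N ／ ({f} : Set α)) ＼ ({e} : Set α)) (k := 5)
    (by rw [hcard₀]; omega)
  rw [hcard₀] at hstep hsym
  have e2 : (gr N).card - 6 - 1 = (gr N).card - 2 - 5 := by omega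
  have e3 : (5 : ℕ) - 1 = 4 := by norm_num
  rw [e2, ← hsym, e3]
  have h5 : 5 ≤ (gr N).card - 2 - 4 := by omega
  have h6 := Nat.mul_le_mul_right (biIndepSets ((N ／ ({f} : Set α)) ＼ ({e} : Set α)) 4).card h5
  omega

/-- **THE REDUCTION OF `InOutBottomFive` TO COLOOP-FREE MATROIDS AND TWIN-FREE NON-LOOP POINTS**: by strong induction
on `#E` — a coloop `e` (`in_5 = 0`), a coloop `x ≠ e` (rank `7`: delete `x` to the rank-6 row, where the two sides
are equal; rank `≥ 8`: delete `x` and induct), a loop `e`, a twin of `e` (the nullity-4 step), else the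
hypothesis. -/
theorem inCount_five_le_outCount_six_of_seven_le_of_cf_tf
    (h : ∀ (N : Matroid α) [N.Finite] (e : α), e ∈ gr N → (gr N).card = rk N (gr N) + 5 → 7 ≤ rk N (gr N) →
      (∀ x ∈ gr N, rk N ((gr N).erase x) = rk N (gr N)) → rk N {e} = 1 →
      (∀ f ∈ gr N, f ≠ e → rk N {f} = 1 → f ∉ clF N {e}) → inCount N 5 e ≤ outCount N 6 e)
    (n : ℕ) :
    ∀ (N : Matroid α) [N.Finite] (e : α), (gr N).card = n → e ∈ gr N → (gr N).card = rk N (gr N) + 5 →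
      7 ≤ rk N (gr N) → inCount N 5 e ≤ outCount N 6 e := by
  induction n using Nat.strong_induction_on with
  | _ n ih =>
    intro N _ e hcard he hn hR
    -- `e` a coloop
    by_cases hce : rk N ((gr N).erase e) < rk N (gr N)
    · exact inCount_five_le_outCount_six_of_coloop hn hce
    -- a coloop `x ≠ e`
    by_cases hx : ∃ x ∈ (gr N).erase e, rk N ((gr N).erase x) < rk N (gr N)
    · obtain ⟨x, hx, hco⟩ := hx
      have hxg : x ∈ gr N := (mem_erase.1 hx).2
      have hxe : x ≠ e := (mem_erase.1 hx).1
      have hrk : rk N ((gr N).erase x) + 1 = rk N (gr N) := by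
        have := rk_le_rk_erase_add_one (M := N) (Subset.refl (gr N)) hxg
        omega
      have h1 := inCount_bottom_le_inCount_delete_of_coloop (ν := 5) (e := e) hn hco
      have h2 := outCount_delete_le_outCount_of_coloop' 6 (e := e) hxg hco
      have hn' : (gr (N ＼ ({x} : Set α))).card =
          rk (N ＼ ({x} : Set α)) (gr (N ＼ ({x} : Set α))) + 5 := by
        rw [gr_delete', card_erase_of_mem hxg, rk_delete (Subset.refl _)]; omega
      have he' : e ∈ gr (N ＼ ({x} : Set α)) := by
        rw [gr_delete']; exact mem_erase.2 ⟨hxe.symm, he⟩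
      rcases Nat.lt_or_ge (rk N (gr N)) 8 with h7 | h8
      · -- rank `7`: the minor has rank `6`, where the two sides agree
        have h3 := inCount_five_eq_outCount_six_of_rk_eq_six (N := N ＼ ({x} : Set α)) hn'
          (by rw [gr_delete', rk_delete (Subset.refl _)]; omega) he'
        omega
      · have h3 := ih ((gr N).card - 1) (by omega) (N ＼ ({x} : Set α)) e
          (by rw [gr_delete', card_erase_of_mem hxg]) he' hn'
          (by rw [gr_delete', rk_delete (Subset.refl _)]; omega)
        omega
    -- no coloop at all
    · have hcf : ∀ x ∈ gr N, rk N ((gr N).erase x) = rk N (gr N) := by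
        intro x hxg
        have hle := rk_mono' (M := N) (erase_subset x (gr N))
        by_cases hxe : x = e
        · rw [hxe] at hle ⊢; omega
        · have : ¬ rk N ((gr N).erase x) < rk N (gr N) := fun h => hx ⟨x, mem_erase.2 ⟨hxe, hxg⟩, h⟩
          omega
      -- loop?
      by_cases hl : rk N {e} = 0
      · exact inCount_five_le_outCount_six_of_loop hl
      have hre : rk N {e} = 1 := by
        have := rk_le_card (M := N) {e}
        rw [card_singleton] at this
        omega
      -- twin?
      by_cases htw : ∃ f ∈ gr N, f ≠ e ∧ rk N {f} = 1 ∧ f ∈ clF N {e}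
      · obtain ⟨f, hf, hfe, hrf, hfcl⟩ := htw
        exact inCount_five_le_outCount_six_of_parallel hn hR (fun h' => hfe h'.symm) he hf hre hrf hfcl
      · exact h N e he hn hR hcf hre (fun f hf hfe hrf hfcl => htw ⟨f, hf, hfe, hrf, hfcl⟩)

/-- **`InOutBottomFive` HOLDS AS SOON AS IT HOLDS ON COLOOP-FREE MATROIDS AT TWIN-FREE NON-LOOP POINTS** (§63): the
loop, coloop, twin and rank-6 cases are theorems. -/
theorem inOutBottomFive_of_coloopFree_twinFree
    (h : ∀ (N : Matroid α) [N.Finite] (e : α), e ∈ gr N → (gr N).card = rk N (gr N) + 5 → 7 ≤ rk N (gr N) →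
      (∀ x ∈ gr N, rk N ((gr N).erase x) = rk N (gr N)) → rk N {e} = 1 →
      (∀ f ∈ gr N, f ≠ e → rk N {f} = 1 → f ∉ clF N {e}) → inCount N 5 e ≤ outCount N 6 e) :
    InOutBottomFive α := by
  intro N _ e he hn hR
  exact inCount_five_le_outCount_six_of_seven_le_of_cf_tf h (gr N).card N e rfl he hn hR

end InOutFive

end PercRepro.Cogirth
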